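import Mathlib
import HarnessLib
import Literature.Barriers.ValiantsHypothesis.PartialDerivativesDetPerm
import Summits.ValiantsHypothesis.ValiantsHypothesis.Theses.SummationBits

/-!
# Route SummationBits — support item `HomogeneousRung` (stmt-ValiantsHypothesis-7569)

**Claim settled.** `Summit.ValiantsHypothesis.ValiantsHypothesis.Theses.SummationBits.HomogeneousRung`:
for every `n ≥ 1`, if `per_n = Σ_{i<r} Π_{j<n} ℓ_ij` with affine `ℓ_ij ∈ ℂ[x]` (total degree `≤ 1`,
exactly `n` factors per summand), then `r ≥ binom(n, ⌊n/2⌋)` — the homogeneous rung of the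
summation-bits dial (Nisan–Wigderson 1996; Landsberg 2017, Prop. 7.2.2.1 with Exercise 6.2.2.7).

## Proof (method of partial derivatives, no homogenisation needed)

* `pderiv_eq_C_of_totalDegree_le_one` — a partial derivative of an affine polynomial is a constant.
* `pderiv_finset_prod` — Leibniz rule for `∂_v (Π_{j ∈ S} f j)`.
* `pderiv_prod_mem_span`, `pderiv_mem_span_of_mem_span`, `iterPDeriv_prod_mem_span` — hence every
  `k`-th order iterated partial derivative of a product `Π_j ℓ_j` of `n` affine forms lies in the
  span of the `binom(n, n-k)` sub-products `Π_{j ∈ T} ℓ_j`, `#T = n - k`.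
* `homogeneousRung_proof` — by additivity of derivatives (`iterPDeriv_sum`, tree), the `k`-th order
  partials of `Σ_{i<r} Π_j ℓ_ij` span at most `r · binom(n, k)` dimensions (`finrank_range_le_card`),
  while those of `per_n` span exactly `binom(n,k)²` dimensions (tree, PROVED:
  `Literature.Barriers.ValiantsHypothesis.flatteningRank_perPoly`); at `k = ⌊n/2⌋` this gives
  `binom(n,⌊n/2⌋)² ≤ r · binom(n,⌊n/2⌋)`, i.e. `r ≥ binom(n,⌊n/2⌋)`.

Unconditional (no named fact is assumed); the hypothesis `1 ≤ n` of the item is not used.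

## References

* [NisanWigderson1996] N. Nisan, A. Wigderson, *Lower bounds on arithmetic circuits via partial
  derivatives*, Comput. Complexity 6 (1996/97), Thm. 1 / §3 (homogeneous depth three).
* [LandsbergGCT2017] J. M. Landsberg, *Geometry and Complexity Theory*, CUP 2017, Exercise 6.2.2.7
  (p. 159, hint p. 307) and Prop. 7.2.2.1 (p. 188).
-/

open MvPolynomial Finset

namespace Summit.ValiantsHypothesis.SummationBits

open Literature.Barriers.ValiantsHypothesis Literature.Computability.AlgebraicComplexity

section Affine

variable {K : Type*} [Field K] {σ : Type*}

/-- A polynomial of total degree `≤ 1` (an affine form) has constant partial derivatives: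
`∂_v ℓ = ℓ_{x_v}` (the coefficient of `x_v`). [folklore] -/
theorem pderiv_eq_C_of_totalDegree_le_one (v : σ) {ℓ : MvPolynomial σ K}
    (hℓ : ℓ.totalDegree ≤ 1) : pderiv v ℓ = C (coeff (Finsupp.single v 1) ℓ) := by
  classical
  ext m
  rw [coeff_pderiv, coeff_C]
  by_cases hm : m = 0
  · subst hm
    simp
  · rw [if_neg (Ne.symm hm)]
    have hdeg : ℓ.totalDegree < (m + Finsupp.single v 1).degree := by
      rw [map_add, Finsupp.degree_single]
      have h2 : m.degree ≠ 0 := fun h => hm ((Finsupp.degree_eq_zero_iff m).1 h)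
      omega
    rw [Finsupp.degree_apply] at hdeg
    rw [coeff_eq_zero_of_totalDegree_lt hdeg, zero_mul]

variable {ι : Type*} [DecidableEq ι]

/-- Leibniz rule for a finite product: `∂_v (Π_{j∈S} f_j) = Σ_{j∈S} (Π_{j'∈S∖j} f_{j'}) · ∂_v f_j`.
[folklore] -/
theorem pderiv_finset_prod (v : σ) (S : Finset ι) (f : ι → MvPolynomial σ K) :
    pderiv v (∏ j ∈ S, f j) = ∑ j ∈ S, (∏ j' ∈ S.erase j, f j') * pderiv v (f j) := by
  induction S using Finset.induction_on with
  | empty => simp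
  | insert a S ha ih =>
    rw [Finset.prod_insert ha, pderiv_mul, ih, Finset.sum_insert ha, Finset.erase_insert ha,
      Finset.mul_sum]
    congr 1
    · ring
    · refine Finset.sum_congr rfl fun j hj => ?_
      rw [Finset.erase_insert_of_ne (ne_of_mem_of_not_mem hj ha).symm,
        Finset.prod_insert (fun h => ha (Finset.mem_of_mem_erase h))]
      ring

/-- The first step of the dimension count: for affine `ℓ_j`, `∂_v (Π_{j∈T} ℓ_j)` is a linear
combination of the sub-products over the `(#T - 1)`-subsets `T ∖ j`. [folklore] -/
theorem pderiv_prod_mem_span (ℓ : ι → MvPolynomial σ K) (hℓ : ∀ j, (ℓ j).totalDegree ≤ 1)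
    (v : σ) {m : ℕ} (T : Finset ι) (hT : T.card = m) :
    pderiv v (∏ j ∈ T, ℓ j) ∈
      Submodule.span K (Set.range fun T' : {T' : Finset ι // T'.card = m - 1} =>
        ∏ j ∈ T'.1, ℓ j) := by
  rw [pderiv_finset_prod]
  refine Submodule.sum_mem _ fun j hj => ?_
  rw [pderiv_eq_C_of_totalDegree_le_one v (hℓ j), mul_comm, C_mul']
  refine Submodule.smul_mem _ _ (Submodule.subset_span ⟨⟨T.erase j, ?_⟩, rfl⟩)
  rw [Finset.card_erase_of_mem hj, hT]

/-- `∂_v` maps the span of the `m`-fold sub-products of affine forms into the span of the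
`(m-1)`-fold ones. [folklore] -/
theorem pderiv_mem_span_of_mem_span (ℓ : ι → MvPolynomial σ K) (hℓ : ∀ j, (ℓ j).totalDegree ≤ 1)
    (v : σ) (m : ℕ) {f : MvPolynomial σ K}
    (hf : f ∈ Submodule.span K (Set.range fun T : {T : Finset ι // T.card = m} =>
      ∏ j ∈ T.1, ℓ j)) :
    pderiv v f ∈
      Submodule.span K (Set.range fun T' : {T' : Finset ι // T'.card = m - 1} =>
        ∏ j ∈ T'.1, ℓ j) := by
  induction hf using Submodule.span_induction with
  | mem x hx =>
    obtain ⟨T, rfl⟩ := hx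
    exact pderiv_prod_mem_span ℓ hℓ v T.1 T.2
  | zero => rw [map_zero]; exact Submodule.zero_mem _
  | add x y _ _ hx hy => rw [map_add]; exact Submodule.add_mem _ hx hy
  | smul a x _ hx => rw [Derivation.map_smul]; exact Submodule.smul_mem _ a hx

variable [Fintype ι]

/-- **Nisan–Wigderson's count for one product gate**: every iterated partial derivative of order
`#l` of a product `Π_j ℓ_j` of `n = #ι` affine forms lies in the span of the `binom(n, n - #l)`
sub-products of `n - #l` of the forms. [cite: NisanWigderson1996, §3] -/
theorem iterPDeriv_prod_mem_span (ℓ : ι → MvPolynomial σ K) (hℓ : ∀ j, (ℓ j).totalDegree ≤ 1)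
    (l : List σ) :
    iterPDeriv l (∏ j, ℓ j) ∈
      Submodule.span K (Set.range fun T : {T : Finset ι // T.card = Fintype.card ι - l.length} =>
        ∏ j ∈ T.1, ℓ j) := by
  induction l with
  | nil =>
    exact Submodule.subset_span ⟨⟨Finset.univ, by simp [Finset.card_univ]⟩, rfl⟩
  | cons v l ih =>
    rw [iterPDeriv_cons, List.length_cons, Nat.sub_add_eq]
    exact pderiv_mem_span_of_mem_span ℓ hℓ v _ ih

end Affine

/-- Settles stmt-ValiantsHypothesis-7569 (route SummationBits, support `HomogeneousRung`): a
depth-three expression `per_n = Σ_{i<r} Π_{j<n} ℓ_ij` with affine `ℓ_ij` over `ℂ` has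
`r ≥ binom(n, ⌊n/2⌋)` — the `⌊n/2⌋`-th order partials of the right-hand side span at most
`r · binom(n, ⌊n/2⌋)` dimensions, those of `per_n` exactly `binom(n, ⌊n/2⌋)²`
(`flatteningRank_perPoly`). [cite: LandsbergGCT2017, Prop. 7.2.2.1 and Exercise 6.2.2.7] -/
theorem homogeneousRung_proof :
    Summit.ValiantsHypothesis.ValiantsHypothesis.Theses.SummationBits.HomogeneousRung := by
  unfold Summit.ValiantsHypothesis.ValiantsHypothesis.Theses.SummationBits.HomogeneousRung
  intro n _hn r ℓ hℓ hsum
  classical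
  set k : ℕ := n / 2 with hk
  have hkn : k ≤ n := Nat.div_le_self n 2
  -- the `r · binom(n, n-k)` sub-products `Π_{j ∈ T} ℓ_ij`, `#T = n - k`
  let b : Fin r × {T : Finset (Fin n) // T.card = n - k} → MvPolynomial (Fin n × Fin n) ℂ :=
    fun p => ∏ j ∈ p.2.1, ℓ p.1 j
  -- the `k`-th order partials of `per_n = Σ Π ℓ` lie in their span
  have hle : Submodule.span ℂ (derivSet k (perPoly (Fin n) ℂ)) ≤ Submodule.span ℂ (Set.range b) := by
    rw [Submodule.span_le]
    rintro _ ⟨l, hl, rfl⟩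
    rw [← hsum, iterPDeriv_sum]
    refine Submodule.sum_mem _ fun i _ => ?_
    have hmem := iterPDeriv_prod_mem_span (ℓ i) (hℓ i) l
    refine Submodule.span_mono ?_ hmem
    rintro _ ⟨T, rfl⟩
    exact ⟨(i, ⟨T.1, by rw [T.2, Fintype.card_fin, hl]⟩), rfl⟩
  -- dimension count
  have hfin : Module.finrank ℂ (Submodule.span ℂ (derivSet k (perPoly (Fin n) ℂ))) =
      (n.choose k) ^ 2 := by
    rw [← shiftedPartialsRank_zero_eq ℂ k (perPoly (Fin n) ℂ), flatteningRank_perPoly ℂ n k]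
  haveI : Module.Finite ℂ (Submodule.span ℂ (Set.range b)) :=
    Module.Finite.span_of_finite ℂ (Set.finite_range b)
  have h1 : Module.finrank ℂ (Submodule.span ℂ (derivSet k (perPoly (Fin n) ℂ))) ≤
      Module.finrank ℂ (Submodule.span ℂ (Set.range b)) := Submodule.finrank_mono hle
  have h2 : Module.finrank ℂ (Submodule.span ℂ (Set.range b)) ≤
      Fintype.card (Fin r × {T : Finset (Fin n) // T.card = n - k}) := finrank_range_le_card b
  rw [Fintype.card_prod, Fintype.card_fin, Fintype.card_finset_len, Fintype.card_fin,
    Nat.choose_symm hkn] at h2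
  have key : n.choose k * n.choose k ≤ r * n.choose k := by
    rw [← sq, ← hfin]; exact h1.trans h2
  exact Nat.le_of_mul_le_mul_right key (Nat.choose_pos hkn)

end Summit.ValiantsHypothesis.SummationBits
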